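import Literature.NumberTheory.Automorphic.ArchEndoscopicChartOrbLocal                 -- ★ p850124 (LH3-p03 (g3)): `chartOrbHLoc`, `chartQuotientMeasureHLoc`, `chartHaarHLoc`
import Literature.NumberTheory.Automorphic.ArchEndoscopicChartOrbitalContinuity       -- ★ p849873 (F0P3a-p09 (g5)): `exists_isCompact_forall_exists_mul_endoBlock_mem_of_mem` (split place, column balancing)
import Literature.MeasureTheory.Group.QuotientOrbitalIntegralProperContinuity           -- ★ p849914 (LH3-p01 (g3)): `continuousOn_integral_descConj_of_uniformlyProper`
import HarnessLib

/-!
# The local chart orbital functional at a SPLIT place: compact support of the orbital integrand and continuity at regular hyperbolic chart points — (P-cont-s)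
# (Rogawski 1990 §3.1, §8.3; Shelstad 1979 §4; Deitmar–Echterhoff 2014 Lemma 9.3.3)

Topic `NumberTheory/Automorphic`; namespace `Literature.NumberTheory.Automorphic.UnitaryGroup`.  THEOREMS ONLY (no definition, no instance, no notation, no axiom, no named
fact, no `sorry`).  Cell `pub/hodgecm-mathlib`, line LH3 (closer stub `stub_N9`, crux H413 = `stmt-HodgeConjecture-24833`); brick **(P-cont-s) «spectator continuity + closed
orbit at a split place»** (LH10-p02 (g4) 2026-09-02T07:55:32Z (ii); LH5-p04 (g2) TAKING 08:05Z), the split-place twin of ★ `ArchEndoscopicChartOrbLocalCompactPlace` (p850394):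
the BY-STATEMENT spectator binders `hsupp` ∕ `hcontS` of ★ (N3) `stOrbFamH_insert_cayPt_ne_zero_of_prodData` (p850341) and `hsplit` of ★ (J-H) `…JumpZeroProduct` §4 (p850334)
at a SPLIT place `w ∈ S`.  Author LH5-p04 (g2).  Lane `--kind proof --supports stmt-HodgeConjecture-24833` (count-neutral).

THE MATHEMATICS.  At a split place `w ∈ S` the chart point `endoBlockAt S w cw = diag(e^{x+iθ}, e^{−x+iθ})` (`x = cw 0`, `θ = cw 2`) is regular iff `x ≠ 0`; its centraliser is
the split torus `T_{S,w}` (NONCOMPACT).  Harish-Chandra's compactness statement there is «uniform properness MODULO `T_{S,w}`»: for `K` compact in `{x ≠ 0}` and `C` compact in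
`U(Φ₂)_w`, the cosets `y T_{S,w}` with `y · endoBlockAt S w cw · y⁻¹ ∈ C` for some `cw ∈ K` lie in ONE compact subset of `U(Φ₂)_w ⧸ T_{S,w}` — ★ F0P3a-p09's column-balancing
lemma `exists_isCompact_forall_exists_mul_endoBlock_mem_of_mem` gives a compact `B` with `y · diag(r, r⁻¹) ∈ B`, and `diag(r, r⁻¹) ∈ T_{S,w}`.
* §1 **`uniformlyProper_endoBlockAt_of_mem`** — the local (HYP) of ★ `continuousOn_integral_descConj_of_uniformlyProper` at one split place.
* §2 **`hasCompactSupport_descConj_endoBlockAt_of_mem`** — compact support of `y T ↦ f(y · endoBlockAt S w cw · y⁻¹)` on `U(Φ₂)_w ⧸ T_{S,w}` at a regular hyperbolic chart point,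
  `f ∈ C_c` (= `hsupp` at split spectators).
* §3 **`continuousAt_chartOrbHLoc_of_mem`** — `ContinuousAt (chartOrbHLoc L S w ν_w f) cw` at `cw 0 ≠ 0` for `f ∈ C_c(U(Φ₂)_w, ℂ)` and any `ν_w` finite on compacta, right invariant
  (= `hcontS` ∕ `hsplit`): ★ generic engine on the open set `{x ≠ 0}` with the quotient measure `dν_w ∕ dt_w` (Radon), times the box prefactor.
HONEST LABEL: HC_CM is proved only modulo the 7 printed citations (2 remaining: hLiu418 = stmt-HodgeConjecture-24832, h413 = stmt-HodgeConjecture-24833) until rung 0 closes;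
topology∕measure bookkeeping, pays nothing by itself.

## References
* [Rogawski1990] J. D. Rogawski, *Automorphic Representations of Unitary Groups in Three Variables*, Ann. of Math. Stud. 123 (1990), §3.1 p. 19, §8.3 pp. 122–124.
* [Shelstad1979] D. Shelstad, *Characters and inner forms of a quasi-split group over ℝ*, Compositio Math. 39 (1979) 11–45, §4 pp. 22–25.
* [DeitmarEchterhoff2014] A. Deitmar, S. Echterhoff, *Principles of Harmonic Analysis*, 2nd ed., Lemma 9.3.3, Thm. 1.5.3.
-/

set_option autoImplicit false

noncomputable section

open MeasureTheory MeasureTheory.Measure NumberField NumberField.InfinitePlace Matrix Complex Topology Filter Set Function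
open Literature.MeasureTheory.Group
open scoped MatrixGroups Matrix

namespace Literature.NumberTheory.Automorphic.UnitaryGroup

/-! ## §1 Uniform properness modulo the split torus at one place -/

section Proper

variable (L : Type) [Field L] (S : Finset {w : InfinitePlace L // IsComplex w}) (w : {w : InfinitePlace L // IsComplex w})

/-- **UNIFORM PROPERNESS MODULO `T_{S,w}` AT A SPLIT PLACE** (Harish-Chandra's compactness lemma, split Cartan of `U(1,1)`): for `w ∈ S`, a compact `K` of local triples with
`cw 0 ≠ 0` and a compact `C ⊆ U(Φ₂)_w`, the cosets `y T_{S,w}` with `y · endoBlockAt S w cw · y⁻¹ ∈ C` for some `cw ∈ K` lie in one compact subset of `U(Φ₂)_w ⧸ T_{S,w}`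
(★ `exists_isCompact_forall_exists_mul_endoBlock_mem_of_mem`: `y · diag(r, r⁻¹) ∈ B`; `diag(r, r⁻¹) = endoBlockAt S w (log-coordinates) ∈ T_{S,w}`).  This is the hypothesis
`hprop` of ★ `continuousOn_integral_descConj_of_uniformlyProper` for the chart `endoBlockAt L S w` on `{cw | cw 0 ≠ 0}`.
[cite: Rogawski1990, §3.1 p. 19; §8.3 p. 122] [cite: DeitmarEchterhoff2014, Lemma 9.3.3] -/
theorem uniformlyProper_endoBlockAt_of_mem (hw : w ∈ S) :
    ∀ K ⊆ {cw : Fin 3 → ℝ | cw 0 ≠ 0}, IsCompact K →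
      ∀ C : Set ↥(archLocal L 2 (Matrix.of fun i j : Fin 2 => if i.val + j.val + 1 = 2 then (1 : L) else 0) w), IsCompact C →
        ∃ 𝒦 : Set (↥(archLocal L 2 (Matrix.of fun i j : Fin 2 => if i.val + j.val + 1 = 2 then (1 : L) else 0) w) ⧸ chartTorusHLoc L S w), IsCompact 𝒦 ∧
          ∀ cw ∈ K, ∀ y : ↥(archLocal L 2 (Matrix.of fun i j : Fin 2 => if i.val + j.val + 1 = 2 then (1 : L) else 0) w),
            y * endoBlockAt L S w cw * y⁻¹ ∈ C → (QuotientGroup.mk y : _ ⧸ chartTorusHLoc L S w) ∈ 𝒦 := by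
  intro K hKsub hK C hC
  -- the global-coordinate copy of `K` (constant in the place variable)
  set K' : Set ({w : InfinitePlace L // IsComplex w} → Fin 3 → ℝ) := (fun cw : Fin 3 → ℝ => fun _ => cw) '' K with hK'
  have hK'c : IsCompact K' := hK.image (continuous_pi fun _ => continuous_id)
  have hK'0 : ∀ c ∈ K', c w 0 ≠ 0 := by
    rintro c ⟨cw, hcw, rfl⟩
    exact hKsub hcw
  obtain ⟨B, hB, hmem⟩ := exists_isCompact_forall_exists_mul_endoBlock_mem_of_mem L w S hw hK'c hK'0 hC
  refine ⟨QuotientGroup.mk '' B, hB.image QuotientGroup.continuous_mk, fun cw hcw y hy => ?_⟩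
  have hy' : y * endoBlock L S (fun _ => cw) w * y⁻¹ ∈ C := by
    rw [endoBlock_eq_endoBlockAt]
    exact hy
  obtain ⟨x', hx'⟩ := hmem (fun _ => cw) ⟨cw, hcw, rfl⟩ y hy'
  refine ⟨y * endoBlock L S (fun _ => ![x', 0, 0]) w, hx', ?_⟩
  rw [QuotientGroup.mk_mul_of_mem]
  rw [endoBlock_eq_endoBlockAt]
  exact endoBlockAt_mem_chartTorusHLoc L S w _

end Proper

/-! ## §2 Compact support of the orbital integrand on the quotient at a regular hyperbolic chart point -/

section Support

variable (L : Type) [Field L] (S : Finset {w : InfinitePlace L // IsComplex w}) (w : {w : InfinitePlace L // IsComplex w})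

/-- **THE ORBITAL INTEGRAND ON `U(Φ₂)_w ⧸ T_{S,w}` AT A REGULAR SPLIT CHART POINT HAS COMPACT SUPPORT** — the `hsupp` binder of ★ (N3) and ★ (N2a) at a split spectator place:
for `w ∈ S`, `cw 0 ≠ 0` and `f` compactly supported, `y T ↦ f(y · endoBlockAt S w cw · y⁻¹)` vanishes off the compact `𝒦` of §1 (`K = {cw}`, `C = tsupport f`).
[cite: Rogawski1990, §8.3 p. 122] [cite: DeitmarEchterhoff2014, Lemma 9.3.3] -/
theorem hasCompactSupport_descConj_endoBlockAt_of_mem (hw : w ∈ S) {cw : Fin 3 → ℝ} (hx : cw 0 ≠ 0)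
    {E' : Type*} [Zero E'] [TopologicalSpace E']
    (f : ↥(archLocal L 2 (Matrix.of fun i j : Fin 2 => if i.val + j.val + 1 = 2 then (1 : L) else 0) w) → E') (hfc : HasCompactSupport f) :
    HasCompactSupport (descConj (endoBlockAt L S w cw) (chartTorusHLoc L S w) (forall_mem_chartTorusHLoc_comm L S w cw) f) := by
  haveI : IsClosed ((chartTorusHLoc L S w : Subgroup ↥(archLocal L 2 (Matrix.of fun i j : Fin 2 => if i.val + j.val + 1 = 2 then (1 : L) else 0) w)) :
      Set ↥(archLocal L 2 (Matrix.of fun i j : Fin 2 => if i.val + j.val + 1 = 2 then (1 : L) else 0) w)) := isClosed_chartTorusHLoc L S w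
  obtain ⟨𝒦, h𝒦, hmem⟩ := uniformlyProper_endoBlockAt_of_mem L S w hw {cw} (by simpa using hx) isCompact_singleton (tsupport f) hfc.isCompact
  refine HasCompactSupport.intro h𝒦 fun y hy => ?_
  induction y using QuotientGroup.induction_on with
  | H g =>
    rw [descConj_mk]
    exact image_eq_zero_of_notMem_tsupport fun hg => hy (hmem cw (mem_singleton cw) g hg)

end Support

/-! ## §3 Continuity of the local chart functional at regular hyperbolic triples -/

section ContinuityAt

variable (L : Type) [Field L] (S : Finset {w : InfinitePlace L // IsComplex w}) (w : {w : InfinitePlace L // IsComplex w})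
  [MeasurableSpace ↥(archLocal L 2 (Matrix.of fun i j : Fin 2 => if i.val + j.val + 1 = 2 then (1 : L) else 0) w)]
  [BorelSpace ↥(archLocal L 2 (Matrix.of fun i j : Fin 2 => if i.val + j.val + 1 = 2 then (1 : L) else 0) w)]
  (νw : Measure ↥(archLocal L 2 (Matrix.of fun i j : Fin 2 => if i.val + j.val + 1 = 2 then (1 : L) else 0) w)) [IsFiniteMeasureOnCompacts νw] [νw.IsMulRightInvariant]

/-- **(P-cont-s) THE LOCAL CHART FUNCTIONAL IS CONTINUOUS AT REGULAR SPLIT LOCAL TRIPLES** — the `hcontS` binder of ★ (N3) `stOrbFamH_insert_cayPt_ne_zero_of_prodData` and the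
`hsplit` binder of ★ (J-H) `…JumpZeroProduct` §4: for `w ∈ S`, `ν_w` finite on compacta and right invariant, and `f ∈ C_c(U(Φ₂)_w, ℂ)`, `ContinuousAt (chartOrbHLoc L S w ν_w f) cw`
whenever `cw 0 ≠ 0` (★ `continuousOn_integral_descConj_of_uniformlyProper` on the open set `{cw 0 ≠ 0}` with the Radon quotient measure `dν_w ∕ dt_w`, times the box prefactor).
[cite: Rogawski1990, §8.3 pp. 122–124] [cite: Shelstad1979, §4 p. 22] [cite: DeitmarEchterhoff2014, Lemma 9.3.3; Thm. 1.5.3] -/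
theorem continuousAt_chartOrbHLoc_of_mem (hw : w ∈ S) {cw : Fin 3 → ℝ} (hx : cw 0 ≠ 0)
    (f : ↥(archLocal L 2 (Matrix.of fun i j : Fin 2 => if i.val + j.val + 1 = 2 then (1 : L) else 0) w) → ℂ) (hf : Continuous f) (hfc : HasCompactSupport f) :
    ContinuousAt (chartOrbHLoc L S w νw f) cw := by
  letI : MeasurableSpace (↥(archLocal L 2 (Matrix.of fun i j : Fin 2 => if i.val + j.val + 1 = 2 then (1 : L) else 0) w) ⧸ chartTorusHLoc L S w) := borel _
  haveI : BorelSpace (↥(archLocal L 2 (Matrix.of fun i j : Fin 2 => if i.val + j.val + 1 = 2 then (1 : L) else 0) w) ⧸ chartTorusHLoc L S w) := ⟨rfl⟩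
  have hreg : (chartQuotientMeasureHLoc L S w νw).Regular := by
    unfold chartQuotientMeasureHLoc
    infer_instance
  haveI := hreg
  have hU : IsOpen {c : Fin 3 → ℝ | c 0 ≠ 0} := isOpen_ne_fun (continuous_apply 0) continuous_const
  have hcont : ContinuousOn (fun c : Fin 3 → ℝ =>
      ∫ q, descConj (endoBlockAt L S w c) (chartTorusHLoc L S w) (forall_mem_chartTorusHLoc_comm L S w c) f q ∂(chartQuotientMeasureHLoc L S w νw))
      {c : Fin 3 → ℝ | c 0 ≠ 0} :=
    continuousOn_integral_descConj_of_uniformlyProper (chartTorusHLoc L S w) (continuous_endoBlockAt L S w) (forall_mem_chartTorusHLoc_comm L S w) hU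
      (uniformlyProper_endoBlockAt_of_mem L S w hw) (chartQuotientMeasureHLoc L S w νw) hf hfc
  have heq : chartOrbHLoc L S w νw f = fun c : Fin 3 → ℝ => ((chartHaarHLoc L S w (chartBoxImgLoc L S w)).toReal : ℂ) *
      ∫ q, descConj (endoBlockAt L S w c) (chartTorusHLoc L S w) (forall_mem_chartTorusHLoc_comm L S w c) f q ∂(chartQuotientMeasureHLoc L S w νw) :=
    funext fun c => chartOrbHLoc_def L S w νw f c
  rw [heq]
  exact continuousAt_const.mul (hcont.continuousAt (hU.mem_nhds hx))

end ContinuityAt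

end Literature.NumberTheory.Automorphic.UnitaryGroup

end
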